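import Literature.NumberTheory.GaloisRepresentations.NearlyOrdinaryDeformationHensel
import Literature.NumberTheory.GaloisRepresentations.DeformationFiniteLevel
import Mathlib.Topology.Algebra.OpenSubgroup
import HarnessLib

/-!
# The rigid nearly ordinary lifting condition of a residual datum

Towards CM's existence of the universal nearly ordinary deformation ring
(`Literature.NumberTheory.GaloisRepresentations.nearlyOrdinaryDeformationRing_nonempty`,
Calegari–Mazur, *Nearly ordinary Galois deformations over arbitrary number fields*, §2.2, whose
proof is a pointer to Mazur §30).  Deformations are lifts *up to strict equivalence*; Mazur's
representability theorem (`LiftingCondition.exists_universal_of_finite` of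
`DeformationProfiniteLevel`) is proved in this library for *lifting conditions* — sub-functors of
the functor of framed lifts.  The bridge is a **rigidification** in the style of Skinner–Wiles
(§2.1): after a change of residual basis `E ∈ GL₂(𝒪)`, fix `g₀ ∈ Γ_F` at which `Ē⁻¹ ρ̄ Ē` is
diagonal with distinct eigenvalues (a `p`-distinguished place provides one) and an off-diagonal
position `(i₀, j₀)` and `τ ∈ Γ_F` with `(Ē⁻¹ ρ̄ Ē)(τ)_{i₀ j₀} ≠ 0` (scalar centralizer provides
one); a lift is *rigid* if `ρ(g₀)` is diagonal and `ρ(τ)_{i₀ j₀}` equals a fixed lift `t ∈ 𝒪`.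
Every strict equivalence class of lifts over a Henselian coefficient ring contains exactly one
rigid lift (proved in `NearlyOrdinaryDeformationRingProofs`), so the deformation functor is the
functor of rigid lifts.

This file packages the choices as `NearlyOrdinaryDatum.RigidData` and proves that the rigid
nearly ordinary lifts form a lifting condition `RigidData.liftingCondition` in the sense of
`DeformationFiniteLevel` (functoriality, continuity, and Mazur's §23 gluing axiom for jointly
injective families).  Near-ordinarity at `v ∣ p` is expressed in the closed, polynomial form
`RigidData.NOAt` (a Hensel root `δ` of the characteristic polynomial of `G_v⁻¹ ρ(σ_v) G_v` and the
`D_v`-stability of the line through the special vector), which is visibly functorial and glues;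
its equivalence with the frame formulation is `noAt_iff_exists_frame` (proved downstream).

References: F. Calegari, B. Mazur, *Nearly ordinary Galois deformations over arbitrary number
fields*, J. Inst. Math. Jussieu 8 (2009), §2.1–2.2; B. Mazur, *An introduction to the deformation
theory of Galois representations* (1997), §23, §30; C. Skinner, A. Wiles, *Residually reducible
representations and modular forms*, Publ. IHÉS 89 (1999), §2.1.
-/

noncomputable section

open IsLocalRing Matrix IsDedekindDomain Field
open scoped NumberField

namespace Literature.NumberTheory.GaloisRepresentations

namespace Deformation

/-! ### Stable lines via a determinant -/

section Parallel

variable {A : Type*} [CommRing A]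

/-- The `2 × 2` "parallelism" determinant `det[x | y] = x₀ y₁ - x₁ y₀`. [folklore] -/
def det2 (x y : Fin 2 → A) : A := x 0 * y 1 - x 1 * y 0

/-- `det2` is functorial. [folklore] -/
theorem map_det2 {B : Type*} [CommRing B] (φ : A →+* B) (x y : Fin 2 → A) :
    φ (det2 x y) = det2 (φ ∘ x) (φ ∘ y) := by
  simp [det2]

/-- **Stable line via a determinant**: for `P ∈ GL₂(A)` and any `N`, the lower-left entry of
`P⁻¹ N P` vanishes iff `N (P e₁)` is parallel to `P e₁`, i.e. `det[P e₁ | N P e₁] = 0`. [folklore] -/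
theorem lowerLeft_eq_zero_iff_det2 (P : GL (Fin 2) A) (N : Matrix (Fin 2) (Fin 2) A) :
    ((P⁻¹).val * N * P.val) 1 0 = 0 ↔
      det2 (fun i => P.val i 0) (fun i => (N * P.val) i 0) = 0 := by
  -- write `N P e₁ = P (a, c)ᵀ` with `(a, c) = (P⁻¹ N P) e₁`
  set a : A := ((P⁻¹).val * N * P.val) 0 0 with ha
  set c : A := ((P⁻¹).val * N * P.val) 1 0 with hc
  have hNP : ∀ i, (N * P.val) i 0 = a * P.val i 0 + c * P.val i 1 := by
    intro i
    have h : N * P.val = P.val * ((P⁻¹).val * N * P.val) := by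
      rw [← Matrix.mul_assoc, ← Matrix.mul_assoc, ← Units.val_mul, mul_inv_cancel, Units.val_one,
        Matrix.one_mul]
    rw [h, Matrix.mul_apply, Fin.sum_univ_two]
    ring
  have hdet : det2 (fun i => P.val i 0) (fun i => (N * P.val) i 0) = c * P.val.det := by
    simp only [det2, hNP, Matrix.det_fin_two]
    ring
  rw [hdet]
  constructor
  · intro h; rw [h, zero_mul]
  · intro h
    exact (Matrix.isUnits_det_units P).mul_left_eq_zero.1 h

end Parallel

end Deformation

/-! ### Rigidification data for a residual datum -/

namespace NearlyOrdinaryDatum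

open Deformation

variable {F : Type} [Field F] [NumberField F] {p : ℕ} {𝒪 : Type} [CommRing 𝒪] {k : Type}
  [Field k] [Algebra 𝒪 k] (𝒟 : NearlyOrdinaryDatum F p 𝒪 k)

/-- The residual representation conjugated by `Ē = E mod 𝔪_𝒪`: `r̄' = Ē⁻¹ ρ̄ Ē`. [folklore] -/
def conjResidual (E : GL (Fin 2) 𝒪) : absoluteGaloisGroup F →* GL (Fin 2) k :=
  (MulAut.conj (Matrix.GeneralLinearGroup.map (algebraMap 𝒪 k) E)⁻¹).toMonoidHom.comp 𝒟.residual

/-- Unfolding lemma for `conjResidual`. [folklore] -/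
@[simp] theorem conjResidual_apply (E : GL (Fin 2) 𝒪) (γ : absoluteGaloisGroup F) :
    𝒟.conjResidual E γ = (Matrix.GeneralLinearGroup.map (algebraMap 𝒪 k) E)⁻¹ * 𝒟.residual γ *
      Matrix.GeneralLinearGroup.map (algebraMap 𝒪 k) E := by
  simp [conjResidual]

/-- **Rigidification data** for the residual datum `𝒟` (Skinner–Wiles-style rigidification of
the nearly ordinary deformation problem): a change of residual basis `E ∈ GL₂(𝒪)` and an element
`g₀ ∈ Γ_F` such that `Ē⁻¹ ρ̄(g₀) Ē` is diagonal with distinct entries (available at a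
`p`-distinguished place); an off-diagonal position `(i₀, j₀)` and `τ ∈ Γ_F` at which `Ē⁻¹ ρ̄ Ē` has
a non-zero entry, with a lift `t ∈ 𝒪` of it (available when `ρ̄` has scalar centralizer); lifts
`Fv ∈ GL₂(𝒪)` of the residual frames and distinguished witnesses `σv` at the places above `p`.
[cite: SkinnerWiles1999, §2.1] [cite: CalegariMazur2008, §2.2] -/
structure RigidData where
  /-- The change of basis `E ∈ GL₂(𝒪)`. -/
  E : GL (Fin 2) 𝒪
  /-- The element at which the conjugated residual representation is diagonal. -/
  g₀ : absoluteGaloisGroup F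
  g₀_01 : (𝒟.conjResidual E g₀).val 0 1 = 0
  g₀_10 : (𝒟.conjResidual E g₀).val 1 0 = 0
  g₀_ne : (𝒟.conjResidual E g₀).val 0 0 ≠ (𝒟.conjResidual E g₀).val 1 1
  /-- The normalised off-diagonal position. -/
  i₀ : Fin 2
  /-- The normalised off-diagonal position. -/
  j₀ : Fin 2
  i₀_ne_j₀ : i₀ ≠ j₀
  /-- The element whose `(i₀, j₀)` entry is normalised. -/
  τ : absoluteGaloisGroup F
  /-- The normalised value (a lift to `𝒪`). -/
  t : 𝒪
  t_spec : algebraMap 𝒪 k t = (𝒟.conjResidual E τ).val i₀ j₀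
  t_ne : (𝒟.conjResidual E τ).val i₀ j₀ ≠ 0
  /-- Lifts of the residual frames to `GL₂(𝒪)` (junk at `v ∤ p`). -/
  Fv : HeightOneSpectrum (𝓞 F) → GL (Fin 2) 𝒪
  Fv_spec : ∀ v, (p : 𝓞 F) ∈ v.asIdeal → Matrix.GeneralLinearGroup.map (algebraMap 𝒪 k) (Fv v) = 𝒟.frame v
  /-- Distinguished witnesses at the places above `p` (junk at `v ∤ p`). -/
  σv : ∀ v : HeightOneSpectrum (𝓞 F), absoluteGaloisGroup (v.adicCompletion F)
  σv_spec : ∀ v, (p : 𝓞 F) ∈ v.asIdeal →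
    ((𝒟.frame v)⁻¹ * 𝒟.residual (absGaloisRestrict F (v.adicCompletion F) (σv v)) * 𝒟.frame v).val 0 0 ≠
      ((𝒟.frame v)⁻¹ * 𝒟.residual (absGaloisRestrict F (v.adicCompletion F) (σv v)) * 𝒟.frame v).val 1 1

namespace RigidData

variable {𝒟} (R : 𝒟.RigidData) {A : Type} [CommRing A] [Algebra 𝒪 A]

/-- The change of basis over `A`. [folklore] -/
def EA (A : Type) [CommRing A] [Algebra 𝒪 A] : GL (Fin 2) A := Matrix.GeneralLinearGroup.map (algebraMap 𝒪 A) R.E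

/-- The frame `G_v = E⁻¹ F_v` over `A` at a place `v`. [folklore] -/
def Gv (A : Type) [CommRing A] [Algebra 𝒪 A] (v : HeightOneSpectrum (𝓞 F)) : GL (Fin 2) A :=
  Matrix.GeneralLinearGroup.map (algebraMap 𝒪 A) (R.E⁻¹ * R.Fv v)

/-- The matrix `M_v(ρ) = G_v⁻¹ ρ(σ_v) G_v`. [folklore] -/
def Mv (ρ : absoluteGaloisGroup F →* GL (Fin 2) A) (v : HeightOneSpectrum (𝓞 F)) : Matrix (Fin 2) (Fin 2) A :=
  ((R.Gv A v)⁻¹ * ρ (absGaloisRestrict F (v.adicCompletion F) (R.σv v)) * R.Gv A v).val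

/-- The special vector `x_v(ρ, δ) = G_v ((M_v - δ) e₁)`. [folklore] -/
def xv (ρ : absoluteGaloisGroup F →* GL (Fin 2) A) (v : HeightOneSpectrum (𝓞 F)) (δ : A) : Fin 2 → A :=
  (R.Gv A v).val *ᵥ ![R.Mv ρ v 0 0 - δ, R.Mv ρ v 1 0]

/-- **Near-ordinarity at `v` in rigid (closed, polynomial) form**: there is a Hensel root `δ` of the
characteristic polynomial of `M_v(ρ)` lifting its lower diagonal residue such that the special
vector `x_v(ρ, δ)` spans a `D_v`-stable line. [cite: CalegariMazur2008, Def. 2.2–2.3] -/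
def NOAt (π : A →+* k) (ρ : absoluteGaloisGroup F →* GL (Fin 2) A) (v : HeightOneSpectrum (𝓞 F)) : Prop :=
  ∃ δ : A, π δ = π (R.Mv ρ v 1 1) ∧ IsCharRoot (R.Mv ρ v) δ ∧
    ∀ σ, det2 (R.xv ρ v δ) ((ρ (absGaloisRestrict F (v.adicCompletion F) σ)).val *ᵥ R.xv ρ v δ) = 0

/-- **The rigid lifts of type `𝒟`** over an augmented local `𝒪`-algebra `(A, π)`: continuous lifts of
the conjugated residual representation `Ē⁻¹ ρ̄ Ē`, unramified outside `S`, nearly ordinary at every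
`v ∣ p` (rigid form), with `ρ(g₀)` diagonal and `ρ(τ)_{i₀ j₀} = t`.
[cite: SkinnerWiles1999, §2.1] [cite: CalegariMazur2008, §2.2] -/
structure IsRigidLift [IsLocalRing A] (π : A →+* k) (ρ : absoluteGaloisGroup F →* GL (Fin 2) A) : Prop where
  isAdicContinuous : IsAdicContinuous ρ
  residual_eq : (Matrix.GeneralLinearGroup.map π).comp ρ = 𝒟.conjResidual R.E
  unramified : ∀ v ∉ 𝒟.S, IsUnramifiedAt v ρ
  noAt : ∀ v : HeightOneSpectrum (𝓞 F), (p : 𝓞 F) ∈ v.asIdeal → R.NOAt π ρ v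
  diag_01 : (ρ R.g₀).val 0 1 = 0
  diag_10 : (ρ R.g₀).val 1 0 = 0
  entry_eq : (ρ R.τ).val R.i₀ R.j₀ = algebraMap 𝒪 A R.t

/-! #### Functoriality of the rigid data -/

section Functorial

variable {B : Type} [CommRing B] [Algebra 𝒪 B] (φ : A →ₐ[𝒪] B)

/-- `G_v` is functorial. [folklore] -/
theorem map_Gv (v : HeightOneSpectrum (𝓞 F)) :
    Matrix.GeneralLinearGroup.map (φ : A →+* B) (R.Gv A v) = R.Gv B v := by
  rw [Gv, Gv, ← Matrix.GeneralLinearGroup.map_comp_apply, ← Matrix.GeneralLinearGroup.map_comp,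
    φ.comp_algebraMap]

/-- `E_A` is functorial. [folklore] -/
theorem map_EA : Matrix.GeneralLinearGroup.map (φ : A →+* B) (R.EA A) = R.EA B := by
  rw [EA, EA, ← Matrix.GeneralLinearGroup.map_comp_apply, ← Matrix.GeneralLinearGroup.map_comp,
    φ.comp_algebraMap]

/-- `M_v` is functorial. [folklore] -/
theorem map_Mv (ρ : absoluteGaloisGroup F →* GL (Fin 2) A) (v : HeightOneSpectrum (𝓞 F)) :
    (R.Mv ρ v).map (φ : A →+* B) = R.Mv ((Matrix.GeneralLinearGroup.map (φ : A →+* B)).comp ρ) v := by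
  unfold Mv
  rw [← R.map_Gv φ v, MonoidHom.comp_apply, ← map_inv, ← map_mul, ← map_mul]
  rfl

/-- `x_v` is functorial. [folklore] -/
theorem map_xv (ρ : absoluteGaloisGroup F →* GL (Fin 2) A) (v : HeightOneSpectrum (𝓞 F)) (δ : A) :
    (φ : A →+* B) ∘ R.xv ρ v δ = R.xv ((Matrix.GeneralLinearGroup.map (φ : A →+* B)).comp ρ) v (φ δ) := by
  funext i
  simp only [Function.comp_apply, xv, Matrix.mulVec, dotProduct, Fin.sum_univ_two, Matrix.cons_val_zero,
    Matrix.cons_val_one, map_add, map_mul, map_sub]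
  rw [← R.map_Gv φ v, ← R.map_Mv φ ρ v]
  simp only [Matrix.GeneralLinearGroup.map_apply, Matrix.map_apply, RingHom.coe_coe]

/-- The rigid near-ordinarity condition is functorial (the Hensel root is carried along).
[folklore] -/
theorem NOAt.map [IsLocalRing A] [IsLocalRing B] {πA : A →+* k} {πB : B →+* k}
    (hπ : πB.comp (φ : A →+* B) = πA) {ρ : absoluteGaloisGroup F →* GL (Fin 2) A}
    {v : HeightOneSpectrum (𝓞 F)} (h : R.NOAt πA ρ v) :
    R.NOAt πB ((Matrix.GeneralLinearGroup.map (φ : A →+* B)).comp ρ) v := by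
  obtain ⟨δ, hδ, hroot, hdet⟩ := h
  have hπa : ∀ a, πB ((φ : A →+* B) a) = πA a := fun a => by rw [← hπ]; rfl
  refine ⟨φ δ, ?_, ?_, fun σ => ?_⟩
  · rw [← R.map_Mv φ ρ v, Matrix.map_apply]
    change πB ((φ : A →+* B) δ) = πB ((φ : A →+* B) _)
    rw [hπa, hπa, hδ]
  · rw [← R.map_Mv φ ρ v]; exact hroot.map (φ : A →+* B)
  · have := congrArg (φ : A →+* B) (hdet σ)
    rw [map_zero, map_det2] at this
    rw [← R.map_xv φ ρ v δ]
    convert this using 2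
    funext i
    rw [Function.comp_apply, RingHom.map_mulVec (φ : A →+* B)]
    rfl

end Functorial

/-! #### Residual computations -/

/-- Residually, `M_v(ρ)` is the residual representation in the residual frame at `v`:
`π (M_v(ρ)ᵢⱼ) = ((frame v)⁻¹ ρ̄(σ_v) (frame v))ᵢⱼ`. [folklore] -/
theorem residue_Mv [IsLocalRing A] {π : A →+* k} {ρ : absoluteGaloisGroup F →* GL (Fin 2) A}
    (hπ : ∀ o, π (algebraMap 𝒪 A o) = algebraMap 𝒪 k o)
    (hres : (Matrix.GeneralLinearGroup.map π).comp ρ = 𝒟.conjResidual R.E)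
    (v : HeightOneSpectrum (𝓞 F)) (hv : (p : 𝓞 F) ∈ v.asIdeal) (i j : Fin 2) :
    π (R.Mv ρ v i j) = ((𝒟.frame v)⁻¹ * 𝒟.residual (absGaloisRestrict F (v.adicCompletion F) (R.σv v)) *
      𝒟.frame v).val i j := by
  have hπc : π.comp (algebraMap 𝒪 A) = algebraMap 𝒪 k := RingHom.ext hπ
  have hGv : Matrix.GeneralLinearGroup.map π (R.Gv A v) =
      (Matrix.GeneralLinearGroup.map (algebraMap 𝒪 k) R.E)⁻¹ * 𝒟.frame v := by
    rw [Gv, ← Matrix.GeneralLinearGroup.map_comp_apply, ← Matrix.GeneralLinearGroup.map_comp, hπc, map_mul,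
      map_inv, R.Fv_spec v hv]
  have hρ : Matrix.GeneralLinearGroup.map π (ρ (absGaloisRestrict F (v.adicCompletion F) (R.σv v))) =
      𝒟.conjResidual R.E (absGaloisRestrict F (v.adicCompletion F) (R.σv v)) :=
    DFunLike.congr_fun hres _
  have h1 : Matrix.GeneralLinearGroup.map π ((R.Gv A v)⁻¹ * ρ (absGaloisRestrict F (v.adicCompletion F) (R.σv v)) *
      R.Gv A v) = (𝒟.frame v)⁻¹ * 𝒟.residual (absGaloisRestrict F (v.adicCompletion F) (R.σv v)) * 𝒟.frame v := by
    rw [map_mul, map_mul, map_inv, hGv, hρ, conjResidual_apply]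
    group
  have h2 := Matrix.GeneralLinearGroup.map_apply π i j ((R.Gv A v)⁻¹ *
    ρ (absGaloisRestrict F (v.adicCompletion F) (R.σv v)) * R.Gv A v)
  rw [h1] at h2
  exact h2.symm

/-- The residual hypotheses of Hensel's lemma for `M_v(ρ)`: lower-left entry residually zero and
distinct diagonal residues. [folklore] -/
theorem residue_Mv_lowerLeft [IsLocalRing A] {π : A →+* k} {ρ : absoluteGaloisGroup F →* GL (Fin 2) A}
    (hπ : ∀ o, π (algebraMap 𝒪 A o) = algebraMap 𝒪 k o)
    (hres : (Matrix.GeneralLinearGroup.map π).comp ρ = 𝒟.conjResidual R.E)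
    (v : HeightOneSpectrum (𝓞 F)) (hv : (p : 𝓞 F) ∈ v.asIdeal) :
    π (R.Mv ρ v 1 0) = 0 ∧ π (R.Mv ρ v 0 0) ≠ π (R.Mv ρ v 1 1) := by
  refine ⟨?_, ?_⟩
  · rw [R.residue_Mv hπ hres v hv]; exact 𝒟.frame_spec v hv _
  · rw [R.residue_Mv hπ hres v hv, R.residue_Mv hπ hres v hv]; exact R.σv_spec v hv

end RigidData

/-! ### The lifting condition -/

namespace RigidData

variable {𝒟} (R : 𝒟.RigidData) (hk : Function.Surjective (algebraMap 𝒪 k))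

include hk in
omit [NumberField F] in
/-- Continuity is preserved by morphisms of `Ĉ_𝒪(k)`. [folklore] -/
theorem isAdicContinuous_map {A B : CNLAlgebra 𝒪 k} (φ : A →ₐ[𝒪] B)
    {ρ : absoluteGaloisGroup F →* GL (Fin 2) A} (h : IsAdicContinuous ρ) :
    IsAdicContinuous ((Matrix.GeneralLinearGroup.map (φ : A →+* B)).comp ρ) := by
  intro m
  have hle : maximalIdeal A ^ m ≤ (maximalIdeal B ^ m).comap (φ : A →+* B) := by
    rw [← Ideal.map_le_iff_le_comap]
    exact CNLAlgebra.map_pow_maximalIdeal_le hk φ m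
  let q : A ⧸ maximalIdeal A ^ m →+* B ⧸ maximalIdeal B ^ m := Ideal.quotientMap _ (φ : A →+* B) hle
  have hq : (Ideal.Quotient.mk (maximalIdeal B ^ m)).comp (φ : A →+* B) =
      q.comp (Ideal.Quotient.mk (maximalIdeal A ^ m)) := (Ideal.quotientMap_comp_mk hle).symm
  apply Subgroup.isOpen_mono _ (h m)
  intro γ hγ
  rw [MonoidHom.mem_ker] at hγ ⊢
  rw [MonoidHom.comp_apply, MonoidHom.comp_apply, ← Matrix.GeneralLinearGroup.map_comp_apply,
    ← Matrix.GeneralLinearGroup.map_comp, hq, Matrix.GeneralLinearGroup.map_comp,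
    Matrix.GeneralLinearGroup.map_comp_apply]
  rw [MonoidHom.comp_apply] at hγ
  rw [hγ, map_one]

/-- **The rigid nearly ordinary lifting condition `𝒞_𝒟`** attached to the residual datum `𝒟` and
rigidification data `R`: its admissible lifts over `A ∈ Ĉ_𝒪(k)` are the rigid lifts of type `𝒟`
(`IsRigidLift`).  It satisfies Mazur's axioms for a deformation condition.
[cite: Mazur1997Deformation, §23 and §30] [cite: CalegariMazur2008, §2.2] -/
def liftingCondition : LiftingCondition 𝒪 k (absoluteGaloisGroup F) 2 (𝒟.conjResidual R.E) where
  carrier A := {ρ | R.IsRigidLift (A.residue : A →+* k) ρ}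
  map_mem := by
    intro A B φ ρ h
    have hπ : (B.residue : B →+* k).comp (φ : A →+* B) = A.residue := by
      ext a; exact CNLAlgebra.residue_map hk φ a
    refine ⟨isAdicContinuous_map hk φ h.isAdicContinuous, ?_, fun v hv => ?_, fun v hv => ?_, ?_, ?_, ?_⟩
    · rw [← MonoidHom.comp_assoc, ← Matrix.GeneralLinearGroup.map_comp, hπ, h.residual_eq]
    · intro 𝔓 h𝔓 σ hσ
      rw [MonoidHom.comp_apply, h.unramified v hv 𝔓 h𝔓 σ hσ, map_one]
    · exact RigidData.NOAt.map R φ hπ (h.noAt v hv)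
    · change φ ((ρ R.g₀).val 0 1) = 0
      rw [h.diag_01, map_zero]
    · change φ ((ρ R.g₀).val 1 0) = 0
      rw [h.diag_10, map_zero]
    · change φ ((ρ R.τ).val R.i₀ R.j₀) = algebraMap 𝒪 B R.t
      rw [h.entry_eq, AlgHom.commutes]
  self_mem := by
    refine ⟨?_, ?_, ?_, ?_, R.g₀_01, R.g₀_10, R.t_spec.symm⟩
    · intro m
      apply Subgroup.isOpen_mono _ 𝒟.isOpen_ker_residual
      intro γ hγ
      rw [MonoidHom.mem_ker] at hγ ⊢
      rw [MonoidHom.comp_apply, conjResidual_apply, hγ, mul_one, inv_mul_cancel, map_one]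
    · refine MonoidHom.ext fun γ => Units.ext ?_
      ext i j
      rw [MonoidHom.comp_apply, Matrix.GeneralLinearGroup.map_apply]
      rfl
    · intro v hv 𝔓 h𝔓 σ hσ
      rw [conjResidual_apply, 𝒟.residual_unramified v hv 𝔓 h𝔓 σ hσ, mul_one, inv_mul_cancel]
    · intro v hv
      -- over `k`: `δ = M₁₁`, and the residual frame condition
      have hres : (Matrix.GeneralLinearGroup.map ((CNLAlgebra.self 𝒪 k).residue :
          (CNLAlgebra.self 𝒪 k) →+* k)).comp (𝒟.conjResidual R.E) = 𝒟.conjResidual R.E := by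
        refine MonoidHom.ext fun γ => Units.ext ?_
        ext i j
        rw [MonoidHom.comp_apply, Matrix.GeneralLinearGroup.map_apply]
        rfl
      have hπ : ∀ o, ((CNLAlgebra.self 𝒪 k).residue : (CNLAlgebra.self 𝒪 k) →+* k) (algebraMap 𝒪 k o) =
          algebraMap 𝒪 k o := fun o => rfl
      obtain ⟨h10, hne⟩ := R.residue_Mv_lowerLeft (A := k) hπ hres v hv
      change R.Mv (𝒟.conjResidual R.E) v 1 0 = 0 at h10
      refine ⟨R.Mv (𝒟.conjResidual R.E) v 1 1, rfl, ?_, fun σ => ?_⟩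
      · unfold IsCharRoot; rw [h10]; ring
      · -- `x = (M₀₀ - M₁₁) • G_v e₁` and `G_v⁻¹ r̄' G_v` is upper triangular
        have hup : ((R.Gv k v)⁻¹ * 𝒟.conjResidual R.E (absGaloisRestrict F (v.adicCompletion F) σ) *
            R.Gv k v).val 1 0 = 0 := by
          have h := Matrix.GeneralLinearGroup.map_apply (RingHom.id k) 1 0 ((R.Gv k v)⁻¹ *
            𝒟.conjResidual R.E (absGaloisRestrict F (v.adicCompletion F) σ) * R.Gv k v)
          rw [Matrix.GeneralLinearGroup.map_id] at h
          change ((R.Gv k v)⁻¹ * _ * R.Gv k v).val 1 0 = ((R.Gv k v)⁻¹ * _ * R.Gv k v).val 1 0 at h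
          have hGv : R.Gv k v = (Matrix.GeneralLinearGroup.map (algebraMap 𝒪 k) R.E)⁻¹ * 𝒟.frame v := by
            rw [Gv, map_mul, map_inv, R.Fv_spec v hv]
          rw [hGv, conjResidual_apply]
          have : ((Matrix.GeneralLinearGroup.map (algebraMap 𝒪 k) R.E)⁻¹ * 𝒟.frame v)⁻¹ *
              ((Matrix.GeneralLinearGroup.map (algebraMap 𝒪 k) R.E)⁻¹ *
                𝒟.residual (absGaloisRestrict F (v.adicCompletion F) σ) *
                  Matrix.GeneralLinearGroup.map (algebraMap 𝒪 k) R.E) *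
              ((Matrix.GeneralLinearGroup.map (algebraMap 𝒪 k) R.E)⁻¹ * 𝒟.frame v) =
              (𝒟.frame v)⁻¹ * 𝒟.residual (absGaloisRestrict F (v.adicCompletion F) σ) * 𝒟.frame v := by
            group
          rw [this]
          exact 𝒟.frame_spec v hv σ
        have hpar := (lowerLeft_eq_zero_iff_det2 (R.Gv k v)
          (𝒟.conjResidual R.E (absGaloisRestrict F (v.adicCompletion F) σ)).val).1 hup
        -- `xv = (M₀₀ - M₁₁) • (G_v e₁)`
        have hx : R.xv (𝒟.conjResidual R.E) v (R.Mv (𝒟.conjResidual R.E) v 1 1) =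
            fun i => (R.Mv (𝒟.conjResidual R.E) v 0 0 - R.Mv (𝒟.conjResidual R.E) v 1 1) * (R.Gv k v).val i 0 := by
          funext i
          simp only [xv, h10, Matrix.mulVec, dotProduct, Fin.sum_univ_two, Matrix.cons_val_zero,
            Matrix.cons_val_one]
          ring
        rw [hx]
        simp only [det2, Matrix.mulVec, dotProduct, Fin.sum_univ_two] at hpar ⊢
        simp only [Matrix.mul_apply, Fin.sum_univ_two] at hpar
        linear_combination (R.Mv (𝒟.conjResidual R.E) v 0 0 - R.Mv (𝒟.conjResidual R.E) v 1 1) ^ 2 * hpar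
  residual_eq := fun h => h.residual_eq
  isAdicContinuous := fun h => h.isAdicContinuous
  mem_of_jointly_injective := by
    intro A ι B φ hinj ρ hcont hmem
    -- the index set is nonempty
    have hne : Nonempty ι := by
      by_contra hι
      rw [not_nonempty_iff] at hι
      exact one_ne_zero (hinj 1 fun i => (IsEmpty.false i).elim)
    obtain ⟨i₁⟩ := hne
    have hπ : ∀ i, ((B i).residue : B i →+* k).comp (φ i : A →+* B i) = A.residue := fun i => by
      ext a; exact CNLAlgebra.residue_map hk (φ i) a
    have hres : (Matrix.GeneralLinearGroup.map (A.residue : A →+* k)).comp ρ = 𝒟.conjResidual R.E := by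
      rw [← hπ i₁, Matrix.GeneralLinearGroup.map_comp, MonoidHom.comp_assoc]
      exact (hmem i₁).residual_eq
    have hentry : ∀ (γ : absoluteGaloisGroup F) (a b : Fin 2) (c : A),
        (∀ i, ((Matrix.GeneralLinearGroup.map (φ i : A →+* B i)).comp ρ γ).val a b = φ i c) →
        (ρ γ).val a b = c := by
      intro γ a b c h
      rw [← sub_eq_zero]
      refine hinj _ fun i => ?_
      rw [map_sub, sub_eq_zero, ← h i, MonoidHom.comp_apply, Matrix.GeneralLinearGroup.map_apply]
      rfl
    refine ⟨hcont, hres, fun v hv 𝔓 h𝔓 σ hσ => ?_, fun v hv => ?_, ?_, ?_, ?_⟩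
    · -- unramified: entrywise
      apply Units.ext; ext a b
      refine hentry σ a b ((1 : GL (Fin 2) A).val a b) fun i => ?_
      rw [(hmem i).unramified v hv 𝔓 h𝔓 σ hσ]
      change (1 : Matrix (Fin 2) (Fin 2) (B i)) a b = φ i ((1 : Matrix (Fin 2) (Fin 2) A) a b)
      by_cases hab : a = b
      · subst hab; rw [Matrix.one_apply_eq, Matrix.one_apply_eq, map_one]
      · rw [Matrix.one_apply_ne hab, Matrix.one_apply_ne hab, map_zero]
    · -- near-ordinarity: Hensel root in `A`, detected in the `B i`
      haveI : HenselianRing A (maximalIdeal A) := inferInstance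
      have hπo : ∀ o, (A.residue : A →+* k) (algebraMap 𝒪 A o) = algebraMap 𝒪 k o :=
        fun o => A.residue.commutes o
      obtain ⟨h10, hne10⟩ := R.residue_Mv_lowerLeft hπo hres v hv
      obtain ⟨δ, hδ, hroot⟩ := exists_isCharRoot A.residue_surjective (R.Mv ρ v) h10 hne10
      refine ⟨δ, hδ, hroot, fun σ => hinj _ fun i => ?_⟩
      obtain ⟨δi, hδi, hrooti, hdeti⟩ := (hmem i).noAt v hv
      -- `φ i δ = δi`
      have hφδ : φ i δ = δi := by
        have hπi : ∀ o, ((B i).residue : B i →+* k) (algebraMap 𝒪 (B i) o) = algebraMap 𝒪 k o :=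
          fun o => (B i).residue.commutes o
        obtain ⟨_, hnei⟩ := R.residue_Mv_lowerLeft hπi (hmem i).residual_eq v hv
        refine IsCharRoot.unique (B i).residue_surjective hnei ?_ hrooti ?_ hδi
        · rw [← R.map_Mv (φ i) ρ v]; exact hroot.map _
        · rw [← R.map_Mv (φ i) ρ v, Matrix.map_apply]
          change (B i).residue (φ i δ) = (B i).residue (φ i _)
          rw [CNLAlgebra.residue_map hk, CNLAlgebra.residue_map hk]
          exact hδ
      show (φ i : A →+* B i) (det2 _ _) = 0
      rw [map_det2, R.map_xv (φ i) ρ v δ, hφδ]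
      convert hdeti σ using 2
      funext a
      rw [Function.comp_apply, RingHom.map_mulVec (φ i : A →+* B i), R.map_xv (φ i) ρ v δ, hφδ]
      rfl
    · exact hentry _ 0 1 0 fun i => by rw [(hmem i).diag_01, map_zero]
    · exact hentry _ 1 0 0 fun i => by rw [(hmem i).diag_10, map_zero]
    · exact hentry _ R.i₀ R.j₀ _ fun i => by rw [(hmem i).entry_eq, AlgHom.commutes]

end RigidData

end NearlyOrdinaryDatum

end Literature.NumberTheory.GaloisRepresentations
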